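import Summits.BirchSwinnertonDyer.BirchSwinnertonDyer.Theorems.Rank1ResidualJetWeilTransportSelmer
import HarnessLib

/-!
# Crux V2♭θ `KolyvaginCorankLowerBoundAtTwoTheta` (stmt-BirchSwinnertonDyer-27220), line
# `kolyvagin_depth_split`, inside of S1 (Kolyvagin's prime swap at `2`): piece **P7b** — the UPPER
# bound of the local pairing order at the prime being swapped out, constant `c₇' = 0`
# (helper, PROVED; width seat `bsd-line-krr2-p2` g7)

In the lead's composition `primeSwapAtTwoLossy_core` (`Theorems/KolyvaginRankRigidityAtTwoSwapFromPiecesCore.lean`)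
the hypothesis `hP7b` reads: at the place `v₀` of the Kolyvagin prime `a` being swapped out, for the
auxiliary class `w` with `2^{a₀} · loc_{v₀} w ∈ 𝒯_{v₀}` and the (multiple of the) Kolyvagin class `C`
with `loc_{v₀} C ∈ 𝒯_{v₀}` and `2^{b₀} · loc_{v₀} C = 0`,
`2^{a₀ + b₀ + c₇' − M} · ⟨loc_{v₀} w, loc_{v₀}(w_* C)⟩_{v₀} = 0` in `ℤ/2^M`
(`w_*` the Weil transport `H¹(K, E[2^M]) → H¹(K, E[2^M]^D)`).

This file proves it with **`c₇' = 0`** from exactly TWO local properties of the transverse condition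
`T = 𝒯_{v₀} ≤ H¹(K_{v₀}, E[2^M])`, both of which the transverse package P8 has to deliver anyway and
neither of which involves the Frobenius CLASS of `a` (only the numerics `2^{M+1} ∣ a + 1, a_a`, through
`E[2^{M+1}] ⊂ E(K_{v₀})`):
* (iso) `T` is self-dual under the Weil transport at `v₀` — the lead's `h𝒯sd` at the single place
  `v₀` (`inv.dualTransported 𝒯 w v₀ = 𝒯 v₀`), which makes `T` isotropic: `⟨t, w_* t'⟩ = 0`;
* (pure) `T` is `2^M`-homogeneous ("pure"): `y ∈ T`, `2^b y = 0` ⟹ `y = 2^{M−b} y'` with `y' ∈ T`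
  (true because `T ≅ Hom(Gal(K[a]_λ/K_λ), E[2^M]) ≅ E[2^M]` is a free `ℤ/2^M`-module when
  `2^M ∣ a + 1` and `E[2^M] ⊂ E(K_λ)`).
Then `⟨loc w, w_* loc C⟩ = 2^{M−b₀} ⟨loc w, w_* y'⟩` and `2^{a₀+b₀−M} · 2^{M−b₀}` is a multiple of
`2^{a₀}`, while `⟨2^{a₀} loc w, w_* y'⟩ = 0` by isotropy: the free-module bound
`ord⟨x, y⟩ ≤ ord(x mod T) · ord(y) / 2^M` of Kolyvagin's transverse local condition, at `p = 2`,
with NO loss. (The abstract splitting form `SwapPairing.pow_smul_pairing_eq_zero_of_split` of seat g6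
asks instead for `H¹ = Kum ⊕ T` with `Kum` homogeneous; the present form needs no complement.)

HONEST FRAMING: helper (`--supports` 27220); it discharges the SHAPE of `hP7b` modulo (iso)+(pure)
at the place `v₀`; S1 / V2♭θ are NOT proved; BSD is not proved by any of this.

References: [cite: Kolyvagin1991MathAnn, §2 (proof of Thm. 2.2: the transverse condition at the
prime removed)] [cite: McCallumLMS1991, §4 (local conditions at Kolyvagin primes), §5 Prop. 5.2]
[cite: Howard2004HeegnerKolyvagin, Def. 2.1.6 (dual local condition)].
-/

set_option autoImplicit false
-- the Theorems namespace of this sub repeats the summit name by design (D-0017 nested layout)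
set_option linter.dupNamespace false

noncomputable section

open scoped Classical
open Function NumberField IsDedekindDomain WeierstrassCurve Field
open Literature.NumberTheory.EllipticCurves Literature.NumberTheory.GaloisRepresentations
open Literature.NumberTheory.GaloisCohomology
open Literature.NumberTheory.GaloisRepresentations.DiscreteGaloisModule (localTatePairingZMod
  tateDual SelmerStructure)

namespace Summit.BirchSwinnertonDyer.BirchSwinnertonDyer.Theorems.KolyvaginLowerBoundAtTwo

variable {K : Type} [Field K] [NumberField K] (W : WeierstrassCurve ℚ) [(W.baseChange K).IsElliptic]
  (M : ℕ) [NeZero (2 ^ M)] [Finite (geomTorsion (W.baseChange K) ((2 ^ M : ℕ) : ℤ))]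
  (e : geomTorsion (W.baseChange K) ((2 ^ M : ℕ) : ℤ) → geomTorsion (W.baseChange K) ((2 ^ M : ℕ) : ℤ) →
    AlgebraicClosure K)
  (hμ : ∀ S T, e S T ^ (2 ^ M) = 1)
  (hadd₁ : ∀ S₁ S₂ T, e (S₁ + S₂) T = e S₁ T * e S₂ T)
  (hadd₂ : ∀ S T₁ T₂, e S (T₁ + T₂) = e S T₁ * e S T₂)
  (hgal : ∀ (g : absoluteGaloisGroup K) (S T : geomTorsion (W.baseChange K) ((2 ^ M : ℕ) : ℤ)),
    g • e S T = e (g • S) (g • T))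
  (inv : LocalInvariants K (2 ^ M))
  (𝒯 : SelmerStructure ((W.baseChange K).torsionGaloisModule ((2 ^ M : ℕ) : ℤ)))

/-- **Isotropy of a self-dual local condition.** If the transverse condition `T = 𝒯_v` is self-dual
under the Weil transport at `v` (`inv.dualTransported 𝒯 w v = 𝒯 v`, the lead's `h𝒯sd` at one place),
then `⟨t, w_v t'⟩_v = 0` for all `t, t' ∈ T` (Howard's dual local condition is the annihilator).
[cite: Howard2004HeegnerKolyvagin, Def. 2.1.6] [cite: Kolyvagin1991MathAnn, §2] -/
theorem localTatePairingZMod_localMap_eq_zero_of_selfDual (v : Place K)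
    (h𝒯sd : inv.dualTransported 𝒯
      (weilDualIntertwining (W.baseChange K) (2 ^ M) e hμ hadd₁ hadd₂ hgal) v = 𝒯 v)
    {t t' : galoisCohomology (((W.baseChange K).torsionGaloisModule ((2 ^ M : ℕ) : ℤ)).toLocal v) 1}
    (ht : t ∈ 𝒯 v) (ht' : t' ∈ 𝒯 v) :
    localTatePairingZMod ((W.baseChange K).torsionGaloisModule ((2 ^ M : ℕ) : ℤ)) (2 ^ M) v (inv v) t
      (DiscreteGaloisModule.localMap
        (weilDualIntertwining (W.baseChange K) (2 ^ M) e hμ hadd₁ hadd₂ hgal) v t') = 0 := by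
  rw [← h𝒯sd, LocalInvariants.mem_dualTransported_iff, LocalInvariants.dualSelmerStructure_apply,
    LocalInvariants.mem_dualLocalCondition_iff] at ht'
  exact ht' t ht

/-- **P7b — the upper bound of the pairing order at the prime being swapped out, constant `0`.**
At a place `v` where the transverse condition `T = 𝒯_v` is self-dual under the Weil transport (iso)
and `2^M`-homogeneous (pure: `y ∈ T`, `2^b y = 0 ⟹ y ∈ 2^{M-b} T`): for global classes `w`, `C` with
`loc_v C ∈ T`, `2^{a₀} loc_v w ∈ T` and `2^{b₀} loc_v C = 0`,
`2^{a₀ + b₀ − M} · ⟨loc_v w, loc_v (w_* C)⟩_v = 0` — Kolyvagin's bound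
`ord⟨x, y⟩ ≤ ord(x mod T)·ord(y)/2^M` for the transverse local condition, at `p = 2`, lossless.
This is the hypothesis `hP7b` of `primeSwapAtTwoLossy_core` with `c₇' = 0`, modulo (iso) + (pure) at
`v`. [cite: Kolyvagin1991MathAnn, §2 (proof of Thm. 2.2)] [cite: McCallumLMS1991, §5 Prop. 5.2] -/
theorem pow_smul_localTatePairingZMod_eq_zero_of_transverse (v : Place K)
    (h𝒯sd : inv.dualTransported 𝒯
      (weilDualIntertwining (W.baseChange K) (2 ^ M) e hμ hadd₁ hadd₂ hgal) v = 𝒯 v)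
    (hpure : ∀ y ∈ 𝒯 v, ∀ b : ℕ, ((2 ^ b : ℕ) : ℤ) • y = 0 →
      ∃ y' ∈ 𝒯 v, y = ((2 ^ (M - b) : ℕ) : ℤ) • y')
    (w C : galoisCohomology ((W.baseChange K).torsionGaloisModule ((2 ^ M : ℕ) : ℤ)) 1) {a₀ b₀ : ℕ}
    (hCT : galoisCohomology.localization ((W.baseChange K).torsionGaloisModule ((2 ^ M : ℕ) : ℤ)) v 1 C ∈
      𝒯 v)
    (hwT : ((2 ^ a₀ : ℕ) : ℤ) •
      galoisCohomology.localization ((W.baseChange K).torsionGaloisModule ((2 ^ M : ℕ) : ℤ)) v 1 w ∈ 𝒯 v)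
    (hC0 : ((2 ^ b₀ : ℕ) : ℤ) •
      galoisCohomology.localization ((W.baseChange K).torsionGaloisModule ((2 ^ M : ℕ) : ℤ)) v 1 C = 0) :
    (2 ^ (a₀ + b₀ - M) : ℕ) •
        localTatePairingZMod ((W.baseChange K).torsionGaloisModule ((2 ^ M : ℕ) : ℤ)) (2 ^ M) v (inv v)
          (galoisCohomology.localization ((W.baseChange K).torsionGaloisModule ((2 ^ M : ℕ) : ℤ)) v 1 w)
          (galoisCohomology.localization
            (((W.baseChange K).torsionGaloisModule ((2 ^ M : ℕ) : ℤ)).tateDual (2 ^ M)) v 1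
            (galoisCohomology.map
              (weilDualIntertwining (W.baseChange K) (2 ^ M) e hμ hadd₁ hadd₂ hgal) 1 C)) = 0 := by
  -- (pure): `loc_v C = 2^{M - b₀} y'` with `y' ∈ T`
  obtain ⟨y', hy'T, hy'⟩ := hpure _ hCT b₀ hC0
  -- (iso): `⟨2^{a₀} loc_v w, θ_v y'⟩ = 0`
  have hzero : ((2 ^ a₀ : ℕ) : ℤ) •
      localTatePairingZMod ((W.baseChange K).torsionGaloisModule ((2 ^ M : ℕ) : ℤ)) (2 ^ M) v (inv v)
        (galoisCohomology.localization ((W.baseChange K).torsionGaloisModule ((2 ^ M : ℕ) : ℤ)) v 1 w)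
        (DiscreteGaloisModule.localMap
          (weilDualIntertwining (W.baseChange K) (2 ^ M) e hμ hadd₁ hadd₂ hgal) v y') = 0 := by
    rw [← AddMonoidHom.zsmul_apply, ← map_zsmul]
    exact localTatePairingZMod_localMap_eq_zero_of_selfDual W M e hμ hadd₁ hadd₂ hgal inv 𝒯 v h𝒯sd
      hwT hy'T
  -- localisation commutes with the Weil transport
  have hnat : galoisCohomology.localization
        (((W.baseChange K).torsionGaloisModule ((2 ^ M : ℕ) : ℤ)).tateDual (2 ^ M)) v 1
        (galoisCohomology.map (weilDualIntertwining (W.baseChange K) (2 ^ M) e hμ hadd₁ hadd₂ hgal) 1 C) =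
      DiscreteGaloisModule.localMap (weilDualIntertwining (W.baseChange K) (2 ^ M) e hμ hadd₁ hadd₂ hgal) v
        (galoisCohomology.localization ((W.baseChange K).torsionGaloisModule ((2 ^ M : ℕ) : ℤ)) v 1 C) :=
    galoisCohomology.res_map_one (Place.Completion v)
      (weilDualIntertwining (W.baseChange K) (2 ^ M) e hμ hadd₁ hadd₂ hgal) C
  rw [hnat, hy', map_zsmul, map_zsmul, ← natCast_zsmul, smul_smul, ← Nat.cast_mul, ← pow_add,
    show a₀ + b₀ - M + (M - b₀) = (a₀ + b₀ - M + (M - b₀) - a₀) + a₀ by omega, pow_add, Nat.cast_mul,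
    mul_smul, hzero, smul_zero]

/-- **P7b with an arbitrary constant** (the shape of `hP7b` in `primeSwapAtTwoLossy_core` for any
`c₇'`): the exponent `a₀ + b₀ + c₇' − M ≥ a₀ + b₀ − M` only kills more.
[cite: Kolyvagin1991MathAnn, §2 (proof of Thm. 2.2)] -/
theorem pow_smul_localTatePairingZMod_eq_zero_of_transverse_add (v : Place K)
    (h𝒯sd : inv.dualTransported 𝒯
      (weilDualIntertwining (W.baseChange K) (2 ^ M) e hμ hadd₁ hadd₂ hgal) v = 𝒯 v)
    (hpure : ∀ y ∈ 𝒯 v, ∀ b : ℕ, ((2 ^ b : ℕ) : ℤ) • y = 0 →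
      ∃ y' ∈ 𝒯 v, y = ((2 ^ (M - b) : ℕ) : ℤ) • y')
    (w C : galoisCohomology ((W.baseChange K).torsionGaloisModule ((2 ^ M : ℕ) : ℤ)) 1) {a₀ b₀ : ℕ}
    (c : ℕ)
    (hCT : galoisCohomology.localization ((W.baseChange K).torsionGaloisModule ((2 ^ M : ℕ) : ℤ)) v 1 C ∈
      𝒯 v)
    (hwT : ((2 ^ a₀ : ℕ) : ℤ) •
      galoisCohomology.localization ((W.baseChange K).torsionGaloisModule ((2 ^ M : ℕ) : ℤ)) v 1 w ∈ 𝒯 v)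
    (hC0 : ((2 ^ b₀ : ℕ) : ℤ) •
      galoisCohomology.localization ((W.baseChange K).torsionGaloisModule ((2 ^ M : ℕ) : ℤ)) v 1 C = 0) :
    (2 ^ (a₀ + b₀ + c - M) : ℕ) •
        localTatePairingZMod ((W.baseChange K).torsionGaloisModule ((2 ^ M : ℕ) : ℤ)) (2 ^ M) v (inv v)
          (galoisCohomology.localization ((W.baseChange K).torsionGaloisModule ((2 ^ M : ℕ) : ℤ)) v 1 w)
          (galoisCohomology.localization
            (((W.baseChange K).torsionGaloisModule ((2 ^ M : ℕ) : ℤ)).tateDual (2 ^ M)) v 1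
            (galoisCohomology.map
              (weilDualIntertwining (W.baseChange K) (2 ^ M) e hμ hadd₁ hadd₂ hgal) 1 C)) = 0 := by
  have h := pow_smul_localTatePairingZMod_eq_zero_of_transverse W M e hμ hadd₁ hadd₂ hgal inv 𝒯 v h𝒯sd
    hpure w C hCT hwT hC0
  rw [show a₀ + b₀ + c - M = (a₀ + b₀ + c - M - (a₀ + b₀ - M)) + (a₀ + b₀ - M) by omega, pow_add,
    mul_smul, h, smul_zero]

end Summit.BirchSwinnertonDyer.BirchSwinnertonDyer.Theorems.KolyvaginLowerBoundAtTwo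

end
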